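/-
Copyright (c) 2026 the pub-hodgecm-mathlib formalisation cell (harness21).  Prover seat hodgecm-mathlib-K2E3-p17 (g6), Track B «K2-LIT» ∕ h413
(`stmt-HodgeConjecture-24833`), line `K2_E3_EllipticInputs`, unit U12 §L (LBGL-3J), Richardson road for (LBGL-ge3) at `N = 3` (road owner K2E3-p11),
brick (F-J) = (S-B♭)_Lie, HEAD FILE H «THE BOREL-SLICE DENSITY OF `𝔤𝔩₃(F)`» (socket (LBGL-3J) `sig_K2E3GL3BorelSliceDensity` of U12, ED. 16).  2026-09-04.
-/
import Summits.HodgeConjecture.HodgeConjecture.Theorems.K2E3GL3SplitOrbitalMeasureDensity   -- ★ (this seat, H2a): the split orbital measure is `c′ (√‖disc‖)⁻¹ 1_{𝔤′} μ𝔤`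
import Summits.HodgeConjecture.HodgeConjecture.Theorems.K2E3GL3UpperSliceFubini              -- ★ p857616 (K2E3-p03, A2): `∫_K∫_𝔟 = C ∫_{F³} ‖Δ‖ ∫_{K×N₃}`
import Literature.NumberTheory.Rogawski1990.LocalTransferFundamentalLemma                    -- ★ `IsLocSmooth`
import HarnessLib

/-!
# K2_E3 road (h413), §L (LBGL-3J): THE BOREL-SLICE DENSITY OF `𝔤𝔩₃(F)` — `∫_K ∫_{𝔟₃} f(Ad(k) b) db dk = ∫ f · W_𝔟 dμ𝔤` with
# `W_𝔟 = c · 1[χ has 3 roots in F, disc χ ≠ 0] · ‖disc χ‖^{-1∕2} ∈ L¹_loc`, locally constant on the regular semisimple set, `‖disc‖^{1∕2} W_𝔟` bounded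

Cell `pub/hodgecm-mathlib` (D-0151), Track B, seat K2E3-p17 (g6), deal (D60) = (F-J) of the Richardson road (road owner K2E3-p11; dealer K2E3-plan (g3) 04:52:35Z;
head frozen on the bus 05:05:36Z = socket (LBGL-3J) `sig_K2E3GL3BorelSliceDensity` of `Lines/K2_E3_EllipticInputsSigs_U12Characters.lean` ED. 16, tie BY APPLICATION).
`--supports stmt-HodgeConjecture-24833 --as helper`; THEOREMS ONLY (no definition ∕ instance ∕ notation ∕ named fact ∕ `sorry`); never imports `Cruxes/…/Lines`.
COUNT-NEUTRAL until the planner ties the socket.  NO `[CharZero F]`, NO `ψ`: unlike the `𝔤𝔩₂` twin ★ p857186 the local integrability of `W_𝔟` is not imported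
but FALLS OUT of the local finiteness of the left-hand side.

THE RESULT (**`exists_borelSliceDensity`**) — Harish-Chandra's Lie–Weyl integration formula for the split Cartan of `𝔤𝔩₃` read through `K × 𝔟₃ → 𝔤𝔩₃`:
`W_𝔟(X) = (C·c′) · 1_{𝔤′}(X) · ‖disc χ_X‖_F^{-1∕2}`, `𝔤′ = {disc χ ≠ 0, χ has three roots in F}` (each split regular class is hit `|W| = 6` times with Jacobian
`‖disc‖^{1∕2}`; elliptic and mixed classes not at all).  ASSEMBLY: ★ A2 (`K×𝔟 → F³ × (K×N₃)`, weight `‖Δ‖ = ‖disc‖^{1∕2}`) + ★ H2a (the split orbital measure has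
density `c′(√‖disc‖)⁻¹ 1_{𝔤′}` — charts ★ E1∕E2, stabilisers ★ G1, level structure ★ F1∕F2, pullback ★ G2, `Ad(G)`-invariance ★ D ∕ ★ I, Weyl bookkeeping ★ H1)
+ local finiteness (a compact set of `𝔤𝔩₃` is swept by a bounded box of `𝔟₃` uniformly over `K`) + the Bochner template of ★ p857186 + ★ R′ (local constancy).
[HarishChandra1999AdmissibleDistributions, Thm. 4.4 p. 11, §7 (Thm. 7.7, Lemma 7.8, Lemma 7.9)] [Howe1974, §2 Prop. 3] [HarishChandra1970, Part V §4 Lemma 22]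
HONEST LABEL: HC_CM is proved only modulo the 7 printed citations (2 remaining named inputs: hLiu418 = stmt-HodgeConjecture-24832, h413 = stmt-HodgeConjecture-24833)
until rung 0 closes; (LBGL-3J) is ONE of the two leaves of (LBGL-ge3) at `N = 3` (the other, (LBGL-3E), is K2E3-p11's); count-neutral helper until tied.

## References
* [HarishChandra1999AdmissibleDistributions] Harish-Chandra (notes by S. DeBacker and P. J. Sally, Jr.), *Admissible Invariant Distributions on Reductive p-adic
  Groups*, University Lecture Series 16, AMS (1999), Thm. 4.4, §7.
* [Howe1974] R. Howe, *The Fourier transform and germs of characters (case of GL_n over a p-adic field)*, Math. Ann. 208 (1974), §2 Prop. 3.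
* [HarishChandra1970] Harish-Chandra (van Dijk), *Harmonic Analysis on Reductive p-adic Groups*, LNM 162 (1970), Part V §4.
-/

set_option autoImplicit false
set_option linter.dupNamespace false

noncomputable section

open MeasureTheory Measure Filter Topology Set Matrix ValuativeRel
open scoped MatrixGroups NNReal ENNReal Valued
open Literature.NumberTheory.Rogawski1990
open Literature.NumberTheory.Automorphic Literature.NumberTheory.Automorphic.LocalFieldHaar
open Literature.NumberTheory.GaloisRepresentations Literature.NumberTheory.GaloisRepresentations.IsNonarchimedeanLocalField
open Summit.HodgeConjecture.HodgeConjecture.Cruxes.H413.K2E3GL3OrbitChartDeriv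
open Summit.HodgeConjecture.HodgeConjecture.Cruxes.H413.K2E3GL3SplitOrbitalMeasureDensity
open Summit.HodgeConjecture.HodgeConjecture.Cruxes.H413.K2E3CubicRationalRootsLocallyConstant

namespace Summit.HodgeConjecture.HodgeConjecture.Cruxes.H413.K2E3GL3BorelSliceDensity

variable {F : Type*} [Field F] [ValuativeRel F] [TopologicalSpace F] [IsNonarchimedeanLocalField F]

/-! ## §1  A compact subset of `M₃(F)` lies in a box `M₃(𝔭^{-n})` -/

/-- **A compact set of `3 × 3` matrices has entries in one ball `𝔭^{-n}`** (`M₃(F) = ⋃_n M₃(𝔭^{-n})`, increasing open cover). [cite: WeilBNT1967, Ch. II n° 27] -/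
theorem exists_forall_mem_primePowBall_of_isCompact {S : Set (Matrix (Fin 3) (Fin 3) F)} (hS : IsCompact S) :
    ∃ n : ℕ, ∀ Y ∈ S, ∀ i j, Y i j ∈ primePowBall F (-(n : ℤ)) := by
  classical
  have hcov : S ⊆ ⋃ n : ℕ, {Y : Matrix (Fin 3) (Fin 3) F | ∀ i j, Y i j ∈ primePowBall F (-(n : ℤ))} := by
    intro Y _
    have hm : ∀ p : Fin 3 × Fin 3, ∃ m : ℤ, Y p.1 p.2 ∈ primePowBall F m := fun p => exists_mem_primePowBall (Y p.1 p.2)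
    choose m hm using hm
    refine Set.mem_iUnion.2 ⟨Finset.univ.sup fun p => (m p).natAbs, fun i j => primePowBall_antitone ?_ (hm (i, j))⟩
    have h1 : (m (i, j)).natAbs ≤ Finset.univ.sup fun p : Fin 3 × Fin 3 => (m p).natAbs := Finset.le_sup (f := fun p : Fin 3 × Fin 3 => (m p).natAbs) (Finset.mem_univ (i, j))
    omega
  obtain ⟨n, hn⟩ := hS.elim_directed_cover (fun n : ℕ => {Y : Matrix (Fin 3) (Fin 3) F | ∀ i j, Y i j ∈ primePowBall F (-(n : ℤ))})
    (fun n => Literature.MeasureTheory.Group.isOpen_setOf_forall_mem_primePowBall (F := F) (n := Fin 3) (-(n : ℤ)))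
    hcov (Monotone.directed_le fun a b hab Y (hY : ∀ i j, Y i j ∈ _) i j => primePowBall_antitone (by omega) (hY i j))
  exact ⟨n, fun Y hY => hn hY⟩

/-! ## §2  The head -/

section Head

variable [MeasurableSpace F] [BorelSpace F] [MeasurableSpace (GL (Fin 3) F)] [BorelSpace (GL (Fin 3) F)]
  [MeasurableSpace (Matrix (Fin 3) (Fin 3) F)] [BorelSpace (Matrix (Fin 3) (Fin 3) F)]

/-- **(LBGL-3J) THE BOREL-SLICE DENSITY OF `𝔤𝔩₃(F)`** (see the module docstring): there is `W : 𝔤𝔩₃(F) → ℂ` — namely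
`W(X) = c · 1[disc χ_X ≠ 0 ∧ χ_X has 3 roots in F] · (√‖disc χ_X‖_F)⁻¹`, `c > 0` — locally integrable, with `∫_K ∫_{F⁶} f(k b(r) k⁻¹) dr dk = ∫ f W dμ𝔤` for every
`f ∈ C_c^∞(𝔤𝔩₃(F))`, locally constant on `{disc χ ∈ Fˣ}`, and `√‖disc χ_X‖ · ‖W(X)‖ ≤ c` everywhere.
[cite: HarishChandra1999AdmissibleDistributions, Thm. 4.4 p. 11, Thm. 7.7, Lemma 7.8] [cite: Howe1974, §2 Prop. 3] [cite: HarishChandra1970, Part V §4 Lemma 22] -/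
theorem exists_borelSliceDensity
    (μ𝔤 : Measure (Matrix (Fin 3) (Fin 3) F)) [μ𝔤.IsAddHaarMeasure]
    (κ : Measure ↥(glInt 3 F)) [IsHaarMeasure κ] (dx : Measure F) [dx.IsAddHaarMeasure] :
    ∃ W : Matrix (Fin 3) (Fin 3) F → ℂ, LocallyIntegrable W μ𝔤 ∧
      (∀ f : Matrix (Fin 3) (Fin 3) F → ℂ, IsLocSmooth f →
        ∫ k : ↥(glInt 3 F), ∫ r : Fin 6 → F,
            f (((k : GL (Fin 3) F) : Matrix (Fin 3) (Fin 3) F) * !![r 0, r 1, r 2; 0, r 3, r 4; 0, 0, r 5] *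
              ((((k : GL (Fin 3) F))⁻¹ : GL (Fin 3) F) : Matrix (Fin 3) (Fin 3) F)) ∂(Measure.pi fun _ : Fin 6 => dx) ∂κ = ∫ X, f X * W X ∂μ𝔤) ∧
      (∀ X : Matrix (Fin 3) (Fin 3) F, IsUnit X.charpoly.discr → ∀ᶠ Y in 𝓝 X, W Y = W X) ∧
      (∀ C : Set (Matrix (Fin 3) (Fin 3) F), IsCompact C → ∃ B : ℝ, ∀ X ∈ C,
          ((NNReal.sqrt (normAbs F X.charpoly.discr) : ℝ≥0) : ℝ) * ‖W X‖ ≤ B) := by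
  classical
  haveI : T2Space F := (isLocalField F).toT2Space
  haveI : LocallyCompactSpace F := (isLocalField F).toLocallyCompactSpace
  haveI : SecondCountableTopology F := secondCountableTopology_localField F
  haveI : IsTopologicalRing F := inferInstance
  haveI : T2Space (GL (Fin 3) F) := t2Space_generalLinearGroup F 3
  haveI : SecondCountableTopology (Matrix (Fin 3) (Fin 3) F) := inferInstanceAs (SecondCountableTopology (Fin 3 → Fin 3 → F))
  haveI : LocallyCompactSpace (Matrix (Fin 3) (Fin 3) F) := Pi.locallyCompactSpace_of_finite
  haveI : SecondCountableTopology (Matrix (Fin 3) (Fin 3) F)ᵐᵒᵖ := MulOpposite.opHomeomorph.symm.secondCountableTopology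
  haveI : SecondCountableTopology (GL (Fin 3) F) := Units.isEmbedding_embedProduct.secondCountableTopology
  haveI : SecondCountableTopology ↥(glInt 3 F) := TopologicalSpace.Subtype.secondCountableTopology _
  haveI : BorelSpace ↥(glInt 3 F) := Subtype.borelSpace _
  haveI : CompactSpace ↥(glInt 3 F) := isCompact_iff_compactSpace.1 (isCompact_glInt (n := 3) (F := F))
  haveI : IsFiniteMeasure κ := CompactSpace.isFiniteMeasure
  haveI : LocallyCompactSpace (GL (Fin 3) F) := locallyCompactSpace_generalLinearGroup F 3
  haveI : LocallyCompactSpace ↥(unipotentRadicalGL F (id : Fin 3 → Fin 3)) :=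
    (isClosed_unipotentRadicalGL (R := F) (id : Fin 3 → Fin 3)).locallyCompactSpace
  haveI : BorelSpace ↥(unipotentRadicalGL F (id : Fin 3 → Fin 3)) := Subtype.borelSpace _
  haveI : SFinite dx := inferInstance
  -- a Haar measure on `N₃` (auxiliary), ★ A2 and ★ H2a
  set μN : Measure ↥(unipotentRadicalGL F (id : Fin 3 → Fin 3)) := Measure.haar with hμN
  obtain ⟨C, hC0, hCt, hA2⟩ := K2E3GL3UpperSliceFubini.lintegral_glInt_upperSlice_eq (F := F) κ μN dx
  obtain ⟨c', hc'0, hc't, hH⟩ := exists_lintegral_delta_orbital_eq κ μN μ𝔤 dx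
  -- the weight and the density
  set 𝔤' : Set (Matrix (Fin 3) (Fin 3) F) := {Y : Matrix (Fin 3) (Fin 3) F | Y.charpoly.discr ≠ 0 ∧ Y.charpoly.roots.card = 3} with h𝔤'
  have h𝔤'm : MeasurableSet 𝔤' := (isOpen_setOf_charpoly_discr_ne_zero_and_card_roots_eq 3).measurableSet
  have hdiscm : Measurable fun Y : Matrix (Fin 3) (Fin 3) F => Y.charpoly.discr := (F0P3cStCharTSHCDGroupToLie.continuous_discr_charpoly (K := F)).measurable
  set w : Matrix (Fin 3) (Fin 3) F → ℝ≥0 := 𝔤'.indicator fun Y => (NNReal.sqrt (normAbs F Y.charpoly.discr))⁻¹ with hw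
  have hwm : Measurable w := ((NNReal.continuous_sqrt.measurable.comp (measurable_normAbs.comp hdiscm)).inv).indicator h𝔤'm
  set a : ℝ≥0 := (C * c').toNNReal with ha
  have haC : (a : ℝ≥0∞) = C * c' := ENNReal.coe_toNNReal (ENNReal.mul_ne_top hCt hc't)
  set W : Matrix (Fin 3) (Fin 3) F → ℂ := fun X => (((a * w X : ℝ≥0) : ℝ) : ℂ) with hW
  have hWdens : Measurable fun X : Matrix (Fin 3) (Fin 3) F => a * w X := hwm.const_mul a
  have hWm : Measurable W := Complex.measurable_ofReal.comp (measurable_coe_nnreal_real.comp hWdens)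
  have hnormW : ∀ X, ‖W X‖ = ((a * w X : ℝ≥0) : ℝ) := fun X => by
    rw [hW]; simp only [Complex.norm_real, Real.norm_eq_abs, abs_of_nonneg (NNReal.coe_nonneg _)]
  -- (1) the `ℝ≥0∞` identity against `μ𝔤`
  have hL : ∀ g : Matrix (Fin 3) (Fin 3) F → ℝ≥0∞, Measurable g →
      ∫⁻ k : ↥(glInt 3 F), ∫⁻ r : Fin 6 → F, g (((k : GL (Fin 3) F) : Matrix (Fin 3) (Fin 3) F) * !![r 0, r 1, r 2; 0, r 3, r 4; 0, 0, r 5] *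
          ((((k : GL (Fin 3) F))⁻¹ : GL (Fin 3) F) : Matrix (Fin 3) (Fin 3) F)) ∂(Measure.pi fun _ : Fin 6 => dx) ∂κ =
        ∫⁻ X, ((a * w X : ℝ≥0) : ℝ≥0∞) * g X ∂μ𝔤 := by
    intro g hg
    have hgw : Measurable fun Y : Matrix (Fin 3) (Fin 3) F => g Y * (((NNReal.sqrt (normAbs F Y.charpoly.discr))⁻¹ : ℝ≥0) : ℝ≥0∞) :=
      hg.mul ((NNReal.continuous_sqrt.measurable.comp (measurable_normAbs.comp hdiscm)).inv).coe_nnreal_ennreal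
    rw [hA2 g hg, hH g hg, ← mul_assoc, ← haC, ← lintegral_indicator h𝔤'm, ← lintegral_const_mul _ (hgw.indicator h𝔤'm)]
    refine lintegral_congr fun X => ?_
    simp only [hw, ENNReal.coe_mul, Set.indicator_apply]
    split_ifs <;> simp [mul_comm, mul_left_comm]
  -- (2) the measure identity `Φ_*(κ ⊗ dx⁶) = (a w) · μ𝔤`
  set Φ : ↥(glInt 3 F) × (Fin 6 → F) → Matrix (Fin 3) (Fin 3) F := fun p =>
    ((p.1 : GL (Fin 3) F) : Matrix (Fin 3) (Fin 3) F) * !![p.2 0, p.2 1, p.2 2; 0, p.2 3, p.2 4; 0, 0, p.2 5] *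
      ((((p.1 : GL (Fin 3) F))⁻¹ : GL (Fin 3) F) : Matrix (Fin 3) (Fin 3) F) with hΦ
  have hΦc : Continuous Φ := by
    refine (((Units.continuous_val.comp (continuous_subtype_val.comp continuous_fst))).mul ?_).mul
      (Units.continuous_coe_inv.comp (continuous_subtype_val.comp continuous_fst))
    refine continuous_matrix fun i j => ?_
    fin_cases i <;> fin_cases j <;> simp <;> fun_prop
  have hΦm : Measurable Φ := hΦc.measurable
  have hmeas : (κ.prod (Measure.pi fun _ : Fin 6 => dx)).map Φ = μ𝔤.withDensity fun X => ((a * w X : ℝ≥0) : ℝ≥0∞) := by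
    ext A hA
    rw [Measure.map_apply hΦm hA, withDensity_apply _ hA, ← lintegral_indicator_one (hA.preimage hΦm),
      lintegral_prod _ ((measurable_one.indicator (hA.preimage hΦm)).aemeasurable)]
    have hind : ∀ p : ↥(glInt 3 F) × (Fin 6 → F), (Φ ⁻¹' A).indicator (1 : ↥(glInt 3 F) × (Fin 6 → F) → ℝ≥0∞) p = A.indicator 1 (Φ p) := by
      intro p; simp only [Set.indicator_apply, mem_preimage, Pi.one_apply]
    simp_rw [hind]
    rw [hL (A.indicator 1) (measurable_one.indicator hA), ← lintegral_indicator hA]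
    refine lintegral_congr fun X => ?_
    by_cases hX : X ∈ A
    · rw [indicator_of_mem hX, indicator_of_mem hX, Pi.one_apply, mul_one]
    · rw [indicator_of_notMem hX, indicator_of_notMem hX, mul_zero]
  -- (3) local finiteness ⇒ `W ∈ L¹_loc`
  have hWli : LocallyIntegrable W μ𝔤 := by
    refine (locallyIntegrable_iff).2 fun S hS => ?_
    refine ⟨hWm.aestronglyMeasurable, ?_⟩
    show ∫⁻ X in S, ‖W X‖ₑ ∂μ𝔤 < ∞
    have h1 : ∫⁻ X in S, ‖W X‖ₑ ∂μ𝔤 = ∫⁻ X, ((a * w X : ℝ≥0) : ℝ≥0∞) * S.indicator 1 X ∂μ𝔤 := by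
      rw [← lintegral_indicator hS.measurableSet]
      refine lintegral_congr fun X => ?_
      by_cases hX : X ∈ S
      · rw [indicator_of_mem hX, indicator_of_mem hX, Pi.one_apply, mul_one, ← ofReal_norm, hnormW, ENNReal.ofReal_coe_nnreal]
      · rw [indicator_of_notMem hX, indicator_of_notMem hX, mul_zero]
    rw [h1, ← hL (S.indicator 1) (measurable_one.indicator hS.measurableSet)]
    -- the box: `Ad(K)⁻¹ S` is compact, so its `𝔟`-coordinates are bounded
    have hSK : IsCompact ((fun p : ↥(glInt 3 F) × Matrix (Fin 3) (Fin 3) F =>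
        ((((p.1 : GL (Fin 3) F))⁻¹ : GL (Fin 3) F) : Matrix (Fin 3) (Fin 3) F) * p.2 * ((p.1 : GL (Fin 3) F) : Matrix (Fin 3) (Fin 3) F)) '' (univ ×ˢ S)) :=
      (isCompact_univ.prod hS).image ((((Units.continuous_coe_inv.comp (continuous_subtype_val.comp continuous_fst))).mul continuous_snd).mul
        (Units.continuous_val.comp (continuous_subtype_val.comp continuous_fst)))
    obtain ⟨n, hn⟩ := exists_forall_mem_primePowBall_of_isCompact hSK
    set R : Set (Fin 6 → F) := Set.pi univ fun _ => (primePowBall F (-(n : ℤ)) : Set F) with hR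
    have hR_m : MeasurableSet R := MeasurableSet.univ_pi fun _ => measurableSet_primePowBall _
    have hsub : ∀ (k : ↥(glInt 3 F)) (r : Fin 6 → F), Φ (k, r) ∈ S → r ∈ R := by
      intro k r hkr
      have hb : (!![r 0, r 1, r 2; 0, r 3, r 4; 0, 0, r 5] : Matrix (Fin 3) (Fin 3) F) ∈ (fun p : ↥(glInt 3 F) × Matrix (Fin 3) (Fin 3) F =>
          ((((p.1 : GL (Fin 3) F))⁻¹ : GL (Fin 3) F) : Matrix (Fin 3) (Fin 3) F) * p.2 * ((p.1 : GL (Fin 3) F) : Matrix (Fin 3) (Fin 3) F)) '' (univ ×ˢ S) := by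
        refine ⟨(k, Φ (k, r)), ⟨Set.mem_univ _, hkr⟩, ?_⟩
        simp only [hΦ]
        rw [show ((((k : GL (Fin 3) F))⁻¹ : GL (Fin 3) F) : Matrix (Fin 3) (Fin 3) F) * (((k : GL (Fin 3) F) : Matrix (Fin 3) (Fin 3) F) *
            !![r 0, r 1, r 2; 0, r 3, r 4; 0, 0, r 5] * ((((k : GL (Fin 3) F))⁻¹ : GL (Fin 3) F) : Matrix (Fin 3) (Fin 3) F)) * ((k : GL (Fin 3) F) : Matrix (Fin 3) (Fin 3) F)
            = (((((k : GL (Fin 3) F))⁻¹ : GL (Fin 3) F) : Matrix (Fin 3) (Fin 3) F) * ((k : GL (Fin 3) F) : Matrix (Fin 3) (Fin 3) F)) * !![r 0, r 1, r 2; 0, r 3, r 4; 0, 0, r 5] *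
            (((((k : GL (Fin 3) F))⁻¹ : GL (Fin 3) F) : Matrix (Fin 3) (Fin 3) F) * ((k : GL (Fin 3) F) : Matrix (Fin 3) (Fin 3) F)) by simp only [Matrix.mul_assoc],
          Units.inv_mul, Matrix.one_mul, Matrix.mul_one]
      have he := hn _ hb
      refine Set.mem_univ_pi.2 fun i => ?_
      fin_cases i
      · exact he 0 0
      · exact he 0 1
      · exact he 0 2
      · exact he 1 1
      · exact he 1 2
      · exact he 2 2
    calc ∫⁻ k : ↥(glInt 3 F), ∫⁻ r : Fin 6 → F, S.indicator 1 (((k : GL (Fin 3) F) : Matrix (Fin 3) (Fin 3) F) * !![r 0, r 1, r 2; 0, r 3, r 4; 0, 0, r 5] *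
          ((((k : GL (Fin 3) F))⁻¹ : GL (Fin 3) F) : Matrix (Fin 3) (Fin 3) F)) ∂(Measure.pi fun _ : Fin 6 => dx) ∂κ
        ≤ ∫⁻ k : ↥(glInt 3 F), ∫⁻ r : Fin 6 → F, R.indicator 1 r ∂(Measure.pi fun _ : Fin 6 => dx) ∂κ := by
          refine lintegral_mono fun k => lintegral_mono fun r => ?_
          by_cases hkr : Φ (k, r) ∈ S
          · rw [Set.indicator_of_mem (hsub k r hkr)]
            exact Set.indicator_le_self S 1 (Φ (k, r))
          · rw [Set.indicator_of_notMem (show Φ (k, r) ∉ S from hkr)]; exact zero_le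
      _ = (Measure.pi fun _ : Fin 6 => dx) R * κ univ := by rw [lintegral_indicator_one hR_m, lintegral_const]
      _ < ∞ := by
          refine ENNReal.mul_lt_top ?_ (measure_lt_top κ _)
          rw [hR, Measure.pi_pi]
          exact ENNReal.prod_lt_top fun i _ => (isCompact_primePowBall (F := F) _).measure_lt_top
  refine ⟨W, hWli, fun f hf => ?_, fun X hX => ?_, fun C _ => ⟨(a : ℝ), fun X _ => ?_⟩⟩
  · -- (4) the Bochner identity for `f ∈ C_c^∞`
    have hfm : Measurable f := hf.continuous.measurable
    have hint : Integrable (fun p : ↥(glInt 3 F) × (Fin 6 → F) => f (Φ p)) (κ.prod (Measure.pi fun _ : Fin 6 => dx)) := by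
      refine ⟨(hf.continuous.comp hΦc).aestronglyMeasurable, ?_⟩
      show ∫⁻ p, ‖f (Φ p)‖ₑ ∂(κ.prod (Measure.pi fun _ : Fin 6 => dx)) < ∞
      rw [← lintegral_map (hfm.enorm) hΦm, hmeas, lintegral_withDensity_eq_lintegral_mul _ hWdens.coe_nnreal_ennreal hfm.enorm]
      obtain ⟨M, hM⟩ := hf.continuous.norm.bddAbove_range_of_hasCompactSupport hf.hasCompactSupport.norm
      have hK := (hWli.integrableOn_isCompact hf.hasCompactSupport).2
      calc ∫⁻ X, (fun X => ((a * w X : ℝ≥0) : ℝ≥0∞)) X * ‖f X‖ₑ ∂μ𝔤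
          = ∫⁻ X in tsupport f, ((a * w X : ℝ≥0) : ℝ≥0∞) * ‖f X‖ₑ ∂μ𝔤 := by
            rw [← lintegral_indicator (isClosed_tsupport f).measurableSet]
            refine lintegral_congr fun X => ?_
            by_cases hX : X ∈ tsupport f
            · rw [indicator_of_mem hX]
            · rw [indicator_of_notMem hX, image_eq_zero_of_notMem_tsupport hX, enorm_zero, mul_zero]
        _ ≤ ∫⁻ X in tsupport f, ‖W X‖ₑ * ENNReal.ofReal M ∂μ𝔤 := by
            refine lintegral_mono fun X => ?_
            have h1 : (((a * w X : ℝ≥0) : ℝ≥0∞)) = ‖W X‖ₑ := by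
              rw [← ofReal_norm, hnormW, ENNReal.ofReal_coe_nnreal]
            rw [h1]
            exact mul_le_mul' le_rfl (by rw [← ofReal_norm]; exact ENNReal.ofReal_le_ofReal (hM ⟨X, rfl⟩))
        _ = (∫⁻ X in tsupport f, ‖W X‖ₑ ∂μ𝔤) * ENNReal.ofReal M := lintegral_mul_const _ hWm.enorm
        _ < ∞ := ENNReal.mul_lt_top hK ENNReal.ofReal_lt_top
    calc ∫ k : ↥(glInt 3 F), ∫ r : Fin 6 → F,
          f (((k : GL (Fin 3) F) : Matrix (Fin 3) (Fin 3) F) * !![r 0, r 1, r 2; 0, r 3, r 4; 0, 0, r 5] *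
            ((((k : GL (Fin 3) F))⁻¹ : GL (Fin 3) F) : Matrix (Fin 3) (Fin 3) F)) ∂(Measure.pi fun _ : Fin 6 => dx) ∂κ
        = ∫ p, f (Φ p) ∂(κ.prod (Measure.pi fun _ : Fin 6 => dx)) := (integral_prod _ hint).symm
      _ = ∫ X, f X ∂((κ.prod (Measure.pi fun _ : Fin 6 => dx)).map Φ) := (integral_map hΦm.aemeasurable hf.continuous.aestronglyMeasurable).symm
      _ = ∫ X, (a * w X) • f X ∂μ𝔤 := by rw [hmeas, integral_withDensity_eq_integral_smul hWdens]
      _ = ∫ X, f X * W X ∂μ𝔤 := by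
            refine integral_congr_ae (Filter.Eventually.of_forall fun X => ?_)
            show ((a * w X : ℝ≥0)) • f X = f X * W X
            simp only [hW, NNReal.smul_def, Complex.real_smul, mul_comm]
  · -- (5) local constancy on `{disc χ ≠ 0}`
    have hX0 : X.charpoly.discr ≠ 0 := hX.ne_zero
    have hn0 : 0 < normAbs F X.charpoly.discr := pos_iff_ne_zero.2 ((map_ne_zero (normAbs F)).2 hX0)
    have hcard := eventually_card_roots_charpoly_eq X hX0
    have hcont : ContinuousAt (fun Y : Matrix (Fin 3) (Fin 3) F => normAbs F (Y.charpoly.discr - X.charpoly.discr)) X :=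
      (continuous_normAbs.comp ((F0P3cStCharTSHCDGroupToLie.continuous_discr_charpoly (K := F)).sub continuous_const)).continuousAt
    have hsmall : ∀ᶠ Y in 𝓝 X, normAbs F (Y.charpoly.discr - X.charpoly.discr) < normAbs F X.charpoly.discr := by
      have h0 : normAbs F (X.charpoly.discr - X.charpoly.discr) < normAbs F X.charpoly.discr := by rw [sub_self, map_zero]; exact hn0
      exact hcont.eventually (gt_mem_nhds h0)
    filter_upwards [hcard, hsmall] with Y hYc hYs
    have hnorm : normAbs F Y.charpoly.discr = normAbs F X.charpoly.discr := by
      have := normAbs_add_eq_of_lt hYs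
      rwa [add_sub_cancel] at this
    have hY0 : Y.charpoly.discr ≠ 0 := fun h => by rw [h, map_zero] at hnorm; exact hn0.ne hnorm
    rw [hW]
    simp only [hw, Set.indicator_apply, h𝔤', Set.mem_setOf_eq, hYc, hnorm, hY0, hX0, ne_eq, not_false_eq_true, true_and]
  · -- (6) the bound `√‖disc‖ · ‖W‖ ≤ a`
    rw [hnormW, ← NNReal.coe_mul]
    refine NNReal.coe_le_coe.2 ?_
    rw [mul_left_comm]
    refine mul_le_of_le_one_right zero_le ?_
    simp only [hw, Set.indicator_apply]
    split_ifs
    · exact mul_inv_le_one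
    · rw [mul_zero]; exact zero_le_one

end Head

end Summit.HodgeConjecture.HodgeConjecture.Cruxes.H413.K2E3GL3BorelSliceDensity

end
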